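import Mathlib.RingTheory.Localization.Away.Basic
import Mathlib.Algebra.MonoidAlgebra.Basic
import Mathlib.RingTheory.Adjoin.Basic
import HarnessLib

/-!
# Toric surface programme: the torus algebra `k[ℤ²]` is `TA[r,a][1/xy]`

Support file for crux stmt-ResolutionOfSingularities-15317 (`FrobeniusLadder.FRationalResolution`), line `redirect`,
lead c4 (toric surface programme for rung 4′: all affine toric surfaces `U(r,a) = Spec k[{m ∈ ℤ² : 0 ≤ m₂, a m₂ ≤ r m₁}]`
over every field are resolved by the Hirzebruch–Jung tower of two-chart monomial blow-ups).

This file proves that for `a < r` the Laurent polynomial ring `Lk = k[ℤ²]` is the localization of the toric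
surface algebra `TA[r,a] = k[σ∨ ∩ ℤ²] ⊆ Lk` at the interior monomial `xy = χ^(1,1)`:
* `χ^(1,1)` is a unit of `Lk` (inverse `χ^(-1,-1)`);
* every `ℓ ∈ Lk` satisfies `ℓ · χ^(n,n) ∈ TA[r,a]` for `n ≫ 0` (a lattice point `m` has `m + (n,n) ∈ σ∨` as soon
  as `n ≥ -m₂` and `n (r - a) ≥ a m₂ - r m₁`, which is solvable because `r - a ≥ 1`);
* the structure map `TA[r,a] → Lk` is the injective inclusion.
-/

set_option linter.dupNamespace false

noncomputable section

namespace Summit.ResolutionOfSingularities.ResolutionOfSingularities.Theorems.FRationalResolution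

section Toric

variable (k : Type) [Field k]

/-- The Laurent polynomial ring `k[ℤ²]` (coordinate ring of the 2-torus). -/
local notation3 "Lk" => AddMonoidAlgebra k (ℤ × ℤ)

/-- The lattice points of the dual cone `σ∨ = {m₂ ≥ 0, a m₂ ≤ r m₁}` of `σ = cone((0,1),(r,-a))`. -/
local notation3 "σS[" r ", " a "]" =>
  {m : ℤ × ℤ | 0 ≤ m.2 ∧ ((a : ℕ) : ℤ) * m.2 ≤ ((r : ℕ) : ℤ) * m.1}

/-- The toric surface algebra `k[σ∨ ∩ ℤ²] ⊆ k[ℤ²]`. -/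
local notation3 "TA[" r ", " a "]" =>
  Algebra.adjoin k ((fun m : ℤ × ℤ => AddMonoidAlgebra.single m (1 : k)) '' σS[r, a])

/-- For `a < r`, every lattice point `m ∈ ℤ²` is translated into the cone `σS[r,a]` by a large enough
multiple of the interior vector `(1,1)`: `m + (n,n) ∈ σS[r,a]` as soon as `n ≥ -m₂` and
`n (r - a) ≥ a m₂ - r m₁`. -/
theorem toric_exists_add_diag_mem_cone (r a : ℕ) (har : a < r) (m : ℤ × ℤ) :
    ∃ n : ℕ, m + ((n : ℤ), (n : ℤ)) ∈ σS[r, a] := by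
  obtain ⟨n, hn2, hnN⟩ :
      ∃ n : ℕ, -m.2 ≤ (n : ℤ) ∧ (a : ℤ) * m.2 - (r : ℤ) * m.1 ≤ (n : ℤ) := by
    refine ⟨(-m.2).toNat + ((a : ℤ) * m.2 - (r : ℤ) * m.1).toNat, ?_, ?_⟩
    · have h1 := Int.self_le_toNat (-m.2)
      have h2 : (0 : ℤ) ≤ (((a : ℤ) * m.2 - (r : ℤ) * m.1).toNat : ℕ) := Int.natCast_nonneg _
      push_cast
      linarith
    · have h1 := Int.self_le_toNat ((a : ℤ) * m.2 - (r : ℤ) * m.1)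
      have h2 : (0 : ℤ) ≤ ((-m.2).toNat : ℕ) := Int.natCast_nonneg _
      push_cast
      linarith
  refine ⟨n, ?_, ?_⟩
  · simp only [Prod.snd_add]
    linarith
  · simp only [Prod.fst_add, Prod.snd_add]
    have h3 : (a : ℤ) + 1 ≤ r := by exact_mod_cast har
    nlinarith [mul_nonneg (by linarith : (0 : ℤ) ≤ (r : ℤ) - a - 1) (Int.natCast_nonneg n)]

/-- For `a < r` the torus algebra `Lk = k[ℤ²]` is the localization of the toric surface algebra `TA[r,a]`
at the interior monomial `xy = χ^(1,1)`: `Lk = TA[r,a][1/xy]`. -/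
theorem stub_toric_isLocalization_away (r a : ℕ) (har : a < r) (xy : ↥TA[r, a])
    (hxy : (xy : Lk) = AddMonoidAlgebra.single ((1 : ℤ), (1 : ℤ)) 1) :
    IsLocalization.Away xy Lk := by
  refine IsLocalization.Away.mk xy ?_ ?_ ?_
  · -- `χ^(1,1)` is a unit of `Lk`, with inverse `χ^(-1,-1)`
    rw [Subalgebra.algebraMap_apply, hxy]
    refine IsUnit.of_mul_eq_one (AddMonoidAlgebra.single ((-1 : ℤ), (-1 : ℤ)) (1 : k)) ?_
    rw [AddMonoidAlgebra.single_mul_single, AddMonoidAlgebra.one_def]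
    simp [Prod.mk_zero_zero]
  · -- every Laurent polynomial is moved into `TA[r,a]` by a power of `xy`
    intro s
    induction s using AddMonoidAlgebra.induction_linear with
    | zero => exact ⟨0, 0, by simp⟩
    | add x y hx hy =>
      obtain ⟨m, s, hs⟩ := hx
      obtain ⟨n, t, ht⟩ := hy
      refine ⟨m + n, s * xy ^ n + t * xy ^ m, ?_⟩
      rw [add_mul, map_add, map_mul, map_mul, map_pow, map_pow, ← hs, ← ht]
      ring
    | single m c =>
      obtain ⟨n, hn⟩ := toric_exists_add_diag_mem_cone r a har m
      have hmem : AddMonoidAlgebra.single (m + ((n : ℤ), (n : ℤ))) c ∈ TA[r, a] := by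
        have h1 : AddMonoidAlgebra.single (m + ((n : ℤ), (n : ℤ))) (1 : k) ∈ TA[r, a] :=
          Algebra.subset_adjoin ⟨_, hn, rfl⟩
        have h2 := Subalgebra.smul_mem TA[r, a] h1 c
        rwa [AddMonoidAlgebra.smul_single', mul_one] at h2
      refine ⟨n, ⟨_, hmem⟩, ?_⟩
      rw [Subalgebra.algebraMap_apply, hxy, AddMonoidAlgebra.single_pow,
        AddMonoidAlgebra.single_mul_single]
      simp
  · -- the structure map is the injective inclusion
    intro s t h
    exact ⟨0, by rw [Subtype.val_injective h]⟩

end Toric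

end Summit.ResolutionOfSingularities.ResolutionOfSingularities.Theorems.FRationalResolution

end
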